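import Summits.QuantumFields.YangMills.Theorems.FemtoCutoffLadderUpStepEvGlue

/-!
# Route `FemtoCutoffLadder`: ENGINE GLUE for the Pc revision `PinnedUpStepEx` (stmt-QuantumFields-27379, ∃ φ′) of `PinnedUpStep` (26925, ∀ φ′)
# (bears on crux 26796 `UpStepEv`; rung R2b1 = RECORD-label femto gap — no summit statement is proved here)

Planner `ym-idea-1` g5.  The «conjuncts» sub-stub `stub_pinnedVarPos` of 26925 was refuted (p623444, ym-line-sfw-p1 g12; confirmed fcl-p3 g7): the
fine-translation average of the thinning pull-back annihilates plane-local coarse observables at non-zero perpendicular momentum, so a pinned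
variational step quantified over EVERY `secondValue′`-eigenfunction is hostage to momentum partners.  The critic's price Pc (idea-crit-4 08:17:49Z)
asked for exactly this weakening at the next natural revision: the coarse excited state is CHOSEN (`∃ φ′`), not arbitrary.
* ★★ `upStepEv_of_pinnedUpStepEx : PinnedUpStepEx → UpStepEv` — the same min–max door as `upStepEv_of_pinnedUpStep` (p616170), with `φ′`
  taken from the hypothesis instead of `exists_isPhys_eigenseq`;
* ★ `pinnedUpStepEx_of_pinnedUpStep : PinnedUpStep → PinnedUpStepEx` — the revision is weaker (so the leaf-of-four certificate p619452 and every
  `--supports 26925` partial transfer to 27379 by composition).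
HONEST FRAMING: glue only; the analytic content (eigenvector-level Born–Oppenheimer at two lattice sizes, one-sided autocorrelation of the pulled-back
coarse excitation) is OPEN.  Nothing here concerns infinite volume, the continuum limit or the Clay Yang–Mills mass gap.  No definitions, no `sorry`.
References: T. Balaban, CMP 98 (1985) 17 [cite: Balaban1985Averaging, §1]; M. Lüscher, NPB 219 (1983) 233 [cite: Luscher1983, §3].
-/

set_option autoImplicit false

section

open MeasureTheory
open Literature.MathematicalPhysics.QuantumFieldTheory (Site Edge GaugeConfig torusConfigShift torusConfigShift_apply)
open Literature.MathematicalPhysics.QuantumLattice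

namespace Summit.QuantumFields.YangMills.Theorems.FemtoCutoffLadder

open Summit.QuantumFields.YangMills.Theorems.FemtoTransferGap
open Summit.QuantumFields.YangMills.Theses.FemtoCutoffLadder


/-- ★ The Pc revision is WEAKER: `PinnedUpStep` (26925, ∀ φ′) implies `PinnedUpStepEx` (27379, ∃ φ′), by the existence of a normalised physical
`secondValue`-eigenfunction orthogonal to the ground state (`exists_isPhys_eigenseq`). [folklore] -/
theorem pinnedUpStepEx_of_pinnedUpStep (h : PinnedUpStep) : PinnedUpStepEx := by
  obtain ⟨C, lam0, hlam0, H⟩ := h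
  refine ⟨C, lam0, hlam0, fun lam hlam hle => ?_⟩
  obtain ⟨L0, HL⟩ := H lam hlam hle
  refine ⟨L0, fun L' _ L _ hL0 hlt hlt2 β β' hW hW' hm Ω hΩ hpos hΩ1 heigp Ω' hΩ' c' hc' hcle' hn' heigp' => ?_⟩
  have hβ' : 0 < β' := zero_lt_one.trans_le hW'.1
  obtain ⟨e, hon, heige, -, -⟩ := exists_isPhys_eigenseq (L := L') hβ'
  set φ' : GaugeConfig 3 L' SU2 → ℝ := ((e 1 : physSubmodule L') : GaugeConfig 3 L' SU2 → ℝ) with hφ'def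
  have hφ' : IsPhys φ' := (e 1).2
  have hn1 : l2 φ' φ' = 1 := by have := hon 1 1; simpa using this
  have heig1 : transferApply β' φ' = secondValue su2Rep L' β' • φ' := by
    rw [← levelValue_one]; exact heige 1
  have heig'' : transferApply β' Ω' = topValue su2Rep L' β' • Ω' := by
    funext U; simpa [transferApply] using heigp' U
  have horth : l2 φ' Ω' = 0 :=
    Dirichlet.l2_eq_zero_of_eigen_ne β' hφ' hΩ' heig1 heig'' (PhysL2.secondValue_lt_topValue (L := L') β').ne
  have heigp1 : ∀ U', ∫ V', transferKernel su2Rep β' U' V' * φ' V' ∂(configMeasure SU2 L') = secondValue su2Rep L' β' * φ' U' :=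
    fun U => by simpa [transferApply] using congrFun heig1 U
  exact ⟨φ', hφ', horth, hn1, heigp1, HL L' L hL0 hlt hlt2 β β' hW hW' hm Ω hΩ hpos hΩ1 heigp Ω' hΩ' c' hc' hcle' hn' heigp' φ' hφ' horth hn1 heigp1⟩

/-- ★★ **`PinnedUpStepEx → UpStepEv`** (items 27379 → 26796): the min–max door on the recentered trial vector `ψ − ⟨ψ,Ω⟩Ω`, `ψ = fbar·Ω`, with the
coarse excited eigenfunction `φ′` CHOSEN by the hypothesis. [cite: Luscher1983, §3] [cite: Balaban1985Averaging, §1] -/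
theorem upStepEv_of_pinnedUpStepEx (h : PinnedUpStepEx) : UpStepEv := by
  obtain ⟨C, lam0, hlam0, H⟩ := h
  refine ⟨C, lam0, hlam0, fun lam hlam hle => ?_⟩
  obtain ⟨L0, HL⟩ := H lam hlam hle
  refine ⟨L0, fun L' _ L _ hL0 hlt hlt2 β β' hW hW' hm => ?_⟩
  have hLL : L' ≤ L := hlt.le
  have h2 : L ≤ 2 * L' := hlt2.le
  have hβ0 : 0 < β := zero_lt_one.trans_le hW.1
  have hβ' : 0 < β' := zero_lt_one.trans_le hW'.1
  have hL1 : 1 ≤ L := NeZero.one_le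
  set s : ℝ := C * luscherLambda β L ^ 2 with hsdef
  -- the POSITIVE fine ground state
  obtain ⟨Ω, θ, c, hΩ, hc, hcle, hΩ1, hΩeig, -, -, -⟩ := PhysL2.exists_groundState (L := L) β
  have hpos : ∀ U, 0 < Ω U := fun U => hc.trans_le (hcle U)
  -- coarse ground state `Ω' ≥ c' > 0`
  obtain ⟨Ω', θ', c', hΩ', hc', hcle', hn', heig', -, -, -⟩ := PhysL2.exists_groundState (L := L') β'
  -- pointwise eigen-equations (route vocabulary)
  have heigp : ∀ U, ∫ V, transferKernel su2Rep β U V * Ω V ∂(configMeasure SU2 L) = topValue su2Rep L β * Ω U :=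
    fun U => by simpa [transferApply] using congrFun hΩeig U
  have heigp' : ∀ U', ∫ V', transferKernel su2Rep β' U' V' * Ω' V' ∂(configMeasure SU2 L') = topValue su2Rep L' β' * Ω' U' :=
    fun U => by simpa [transferApply] using congrFun heig' U
  -- the CHOSEN coarse excited eigenfunction `φ'` and the pinned statement at this pair
  obtain ⟨φ', hφ', horth, hn1, heigp1, HB⟩ := HL L' L hL0 hlt hlt2 β β' hW hW' hm Ω hΩ hpos hΩ1 heigp Ω' hΩ' c' hc' hcle' hn' heigp'
  simp only [] at HB
  obtain ⟨hvar, hineq⟩ := HB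
  -- the ratio `φ'/Ω'` is physical on the coarse torus
  obtain ⟨hrm, ⟨Cg, hrb⟩, hrg, hrz, -⟩ := Dirichlet.ratio_multiplier hΩ' hφ' hc' hcle'
  have hratio : IsPhys (fun U' : GaugeConfig 3 L' SU2 => φ' U' / Ω' U') := ⟨hrm, ⟨Cg, hrb⟩, hrg, hrz⟩
  -- its translation-averaged thinning pull-back is physical on the fine torus, bridged to the inline form of the item
  have havg := Thinning.isPhys_avg_thin_shift (G := SU2) hLL h2 hratio
  simp only [torusConfigShift_eq_pinnedInline, thin_eq_pinnedInline] at havg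
  obtain ⟨Cf, hCf⟩ := havg.bounded
  have hw := IsPhys.mul_of_invariant hΩ havg.measurable hCf havg.gaugeInv havg.zeroFlux
  -- the door argument (as in `UpStep.upStepAt_of_moments`) on THIS ground state, trial vector `v = w − ⟨w,Ω⟩Ω`
  have door : ∀ w : GaugeConfig 3 L SU2 → ℝ, IsPhys w → l2 w Ω ^ 2 < l2 w w →
      secondValue su2Rep L' β' ^ L' * topValue su2Rep L β ^ L * (l2 w w - l2 w Ω ^ 2) ≤
        Real.exp s * (topValue su2Rep L' β' ^ L' * (l2 w ((transferApply β)^[L] w) - topValue su2Rep L β ^ L * l2 w Ω ^ 2)) →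
      secondValue su2Rep L' β' ^ L' * topValue su2Rep L β ^ L ≤
        Real.exp s * (secondValue su2Rep L β ^ L * topValue su2Rep L' β' ^ L') := by
    intro w hw' hvar' hineq'
    obtain ⟨hv, hvorth, hnorm, htwo⟩ := UpStep.recentred_moments β hΩ hΩ1 hΩeig hw' L
    set v : GaugeConfig 3 L SU2 → ℝ := w + (-(l2 w Ω)) • Ω with hvdef
    have hvpos : 0 < l2 v v := by rw [hnorm]; linarith
    have hcmp : secondValue su2Rep L' β' ^ L' * topValue su2Rep L β ^ L * l2 v v ≤
        Real.exp s * (topValue su2Rep L' β' ^ L' * l2 v ((transferApply β)^[L] v)) := by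
      rw [hnorm, htwo]; exact hineq'
    have hvarb := UpStep.l2_iterate_le_pow_secondValue hβ0 hΩ hΩ1 hΩeig hv hvorth hL1
    have hb' : 0 ≤ topValue su2Rep L' β' ^ L' := pow_nonneg (topValue_su2Rep_pos L' β').le _
    have h1 : Real.exp s * (topValue su2Rep L' β' ^ L' * l2 v ((transferApply β)^[L] v)) ≤
        Real.exp s * (topValue su2Rep L' β' ^ L' * (secondValue su2Rep L β ^ L * l2 v v)) :=
      mul_le_mul_of_nonneg_left (mul_le_mul_of_nonneg_left hvarb hb') (Real.exp_pos _).le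
    have h2' := hcmp.trans h1
    have h3 : (secondValue su2Rep L' β' ^ L' * topValue su2Rep L β ^ L) * l2 v v ≤
        (Real.exp s * (secondValue su2Rep L β ^ L * topValue su2Rep L' β' ^ L')) * l2 v v := by
      calc (secondValue su2Rep L' β' ^ L' * topValue su2Rep L β ^ L) * l2 v v
          = secondValue su2Rep L' β' ^ L' * topValue su2Rep L β ^ L * l2 v v := by ring
        _ ≤ Real.exp s * (topValue su2Rep L' β' ^ L' * (secondValue su2Rep L β ^ L * l2 v v)) := h2'
        _ = (Real.exp s * (secondValue su2Rep L β ^ L * topValue su2Rep L' β' ^ L')) * l2 v v := by ring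
    exact le_of_mul_le_mul_right h3 hvpos
  exact door _ hw hvar hineq

end Summit.QuantumFields.YangMills.Theorems.FemtoCutoffLadder

end
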